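import Summits.Ventures.CertifiedArithmetic.LowPrec.OptTreePolySignedUpper
import Summits.Ventures.CertifiedArithmetic.LowPrec.RoundNearestInflation

/-!
# Conjecture S′ at height two: the balanced four-leaf tree obeys the signed tree-polynomial law

HONEST FRAMING (venture CertifiedArithmetic / cell `pub-lowprec`): certified error envelopes and
provably optimal rounding/accumulation schemes for low-precision formats under stated cost models;
every table by two implementations; no hardware or vendor claims.

OPTIMA.md Theorem T4: for NONNEGATIVE data every summation tree `t` under-estimates by at most
`1 - 1/M_t(u)` (tree polynomial `M`), attained under ties-to-even.  For SIGNED data the same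
constant ("Conjecture S") is FALSE at every precision `p ≥ 4` (`OptTreePolySignedRefutation`, the
nine-leaf family `τ₉`); what survives in general is the sandwich
`1 - 1/M_t(u) ≤ W_t ≤ M_t(u/(1+u)) - 1` (`OptTreePolySignedUpper`).  `SIGNED-TREE-LAW.md` §3c
records implementation-A evidence that PERFECT (pairwise) trees still obey the signed law
("Conjecture S′").  THIS FILE settles the first open case, for EVERY precision:

  **For data `a, b, c, d` of ANY signs in any format with `m ≥ 1` (every node in range),
  `|fl(fl(a+b) + fl(c+d)) - (a+b+c+d)| ≤ (1 - 1/(1+u)²) · (|a|+|b|+|c|+|d|)`**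

(`signed_law_height_two`, `signed_law_height_two_tree`), i.e. the exact two-sided worst case of
the balanced four-leaf tree `((a,b),(c,d))` IS its tree-polynomial value `(2u+u²)/(1+u)²`
(attained by T4(b)'s nonnegative witness `((1+u), u) ⊕ (u, u²)`, `signed_worst_case_height_two`).
With the caterpillars (every node has a leaf child: Lange–Rump, `AccumulateLangeRump`) this covers
every tree on `n ≤ 4` leaves; the first signed failure is at `n = 8` (`p ≥ 6`) / `n = 9` (`p ≥ 4`).

PROOF — a linear relaxation over sign patterns.  Three facts about one rounded addition `X = fl(x)`
of two data (`x` in range) suffice: (N) `|X - x| ≤ v|x|`, `v = u/(1+u)` [JeannerodRump2018 (4.1)];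
(I) if the rounding INFLATES (`|X| > |x|`) then `|X - x| ≤ w|x|` with `w = u/(1+2u+2u²) < v` — the
RNE inflation asymmetry (`RoundNearestInflation`); (S) `fl` preserves weak signs.  Write the total
error `(a+b+c+d) - ŝ = (α - A) + (γ - C) + ((A+C) - S)` (`α = a+b`, `A = fl α`, …, `S = fl(A+C)`).
If the top error is a deflation (`A + C > S ≥ 0`) it is at most `v(A+C)` and the total splits into
the per-operand pieces `(1-v)(α - A) + vα ≤ (2v - v²)|α|` (`piece_defl`: a deflated operand has lost
what it contributes, `A = α - (α - A)`); if it is an inflation (`S < A + C < 0`) it is at most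
`-w(A+C)` and the pieces are `(1+w)(α - A) - wα ≤ (2v - v²)|α|` (`piece_infl`), whose only
non-trivial instance is the all-inflation chain `2w + w² ≤ 2v - v²` — a polynomial inequality in
`u` that holds with third-order room (`two_infl_le_law`: the difference is
`u³(4 + 11u + 12u² + 4u³)/((1+u)²(1+2u+2u²)²)`).  The mirror image gives the other sign.

SCOPE (honest).  The same relaxation does NOT certify height three: an all-inflation chain of
seven additions would be worth `(1+w)³ - 1 > 1 - 1/(1+u)³` (`relaxation_exceeds_law_height_three`,
second order: `3u²` lost against `6u²` gained), so any proof of Conjecture S′ for the 8-leaf tree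
must use the GRID (which additions can inflate by nearly `w` simultaneously), not only (N)(I)(S).
Placement: (N) is [JeannerodRump2018]; per-tree signed constants are this cell's (OPTIMA §T(f)
search: none in print); the statement and proof here are new as far as searched.
-/

namespace Summit.Ventures.CertifiedArithmetic.LowPrec.Opt

open Literature.ComputerArithmetic.JeannerodRump2018
open Literature.ComputerArithmetic.JeannerodRump2018.SumTree
open Literature.ComputerArithmetic.FloatingPoint
open Literature.ComputerArithmetic.FloatingPoint.MiniFloat

/-! ## §1 The two rates `v = u/(1+u)`, `w = u/(1+2u+2u²)` and the one polynomial inequality -/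

/-- `0 ≤ w ≤ v ≤ 1` for `u ≥ 0`. -/
theorem rates_basic {u : ℚ} (hu : 0 ≤ u) :
    0 ≤ u / (1 + 2 * u + 2 * u ^ 2) ∧ u / (1 + 2 * u + 2 * u ^ 2) ≤ u / (1 + u) ∧
      0 ≤ u / (1 + u) ∧ u / (1 + u) ≤ 1 := by
  have hD1 : 0 < 1 + u := by linarith
  have hD2 : 0 < 1 + 2 * u + 2 * u ^ 2 := by positivity
  refine ⟨div_nonneg hu hD2.le, ?_, div_nonneg hu hD1.le, ?_⟩
  · exact div_le_div_of_nonneg_left hu hD1 (by nlinarith)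
  · rw [div_le_one hD1]; linarith

/-- THE ALL-INFLATION CHAIN IS BELOW THE LAW: `2w + w² ≤ 2v - v²` for every `u ≥ 0`
(difference `u³(4 + 11u + 12u² + 4u³)/((1+u)²(1+2u+2u²)²)`). -/
theorem two_infl_le_law {u : ℚ} (hu : 0 ≤ u) :
    2 * (u / (1 + 2 * u + 2 * u ^ 2)) + (u / (1 + 2 * u + 2 * u ^ 2)) ^ 2
      ≤ 2 * (u / (1 + u)) - (u / (1 + u)) ^ 2 := by
  have hD1 : 0 < 1 + u := by linarith
  have hD2 : 0 < 1 + 2 * u + 2 * u ^ 2 := by positivity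
  have key : 2 * (u / (1 + u)) - (u / (1 + u)) ^ 2
      - (2 * (u / (1 + 2 * u + 2 * u ^ 2)) + (u / (1 + 2 * u + 2 * u ^ 2)) ^ 2)
      = u ^ 3 * (4 + 11 * u + 12 * u ^ 2 + 4 * u ^ 3)
          / ((1 + u) ^ 2 * (1 + 2 * u + 2 * u ^ 2) ^ 2) := by
    field_simp
    ring
  have hnonneg : 0 ≤ u ^ 3 * (4 + 11 * u + 12 * u ^ 2 + 4 * u ^ 3)
      / ((1 + u) ^ 2 * (1 + 2 * u + 2 * u ^ 2) ^ 2) := by positivity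
  linarith

/-- The law of the balanced four-leaf tree: `2v - v² = 1 - 1/(1+u)² = (2u+u²)/(1+u)²`. -/
theorem law_height_two_eq {u : ℚ} (hu : 0 ≤ u) :
    2 * (u / (1 + u)) - (u / (1 + u)) ^ 2 = 1 - 1 / (1 + u) ^ 2 ∧
      1 - 1 / (1 + u) ^ 2 = (2 * u + u ^ 2) / (1 + u) ^ 2 := by
  have hD1 : (1 + u) ≠ 0 := by intro h; linarith
  constructor
  · field_simp; ring
  · field_simp; ring

/-! ## §2 The per-operand pieces -/

/-- ZERO PIECE: `x - X ≤ (2v - v²)|x|` from (N) alone (`0 ≤ v ≤ 1`). -/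
theorem piece_zero {v x X : ℚ} (hv0 : 0 ≤ v) (hv1 : v ≤ 1) (hN : |X - x| ≤ v * |x|) :
    x - X ≤ (2 * v - v ^ 2) * |x| := by
  have h1 : x - X ≤ |X - x| := by rw [abs_sub_comm]; exact le_abs_self _
  have hx := abs_nonneg x
  have h2 : v * |x| ≤ (2 * v - v ^ 2) * |x| := by
    have : 0 ≤ v * (1 - v) * |x| := mul_nonneg (mul_nonneg hv0 (by linarith)) hx
    nlinarith
  linarith

/-- DEFLATION PIECE: if the ancestor deflates, an operand `x ↦ X` contributes
`(1-v)(x - X) + v·x ≤ (2v - v²)|x|` — with equality for a fully deflated positive operand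
(`x > 0`, `x - X = v x`); a negative operand contributes at most `0` here. Uses (N), (I), (S). -/
theorem piece_defl {v w x X : ℚ} (hv0 : 0 ≤ v) (hv1 : v ≤ 1) (hw0 : 0 ≤ w) (hwv : w ≤ v)
    (hN : |X - x| ≤ v * |x|) (hI : |x| < |X| → |X - x| ≤ w * |x|) (hSm : x ≤ 0 → X ≤ 0) :
    (1 - v) * (x - X) + v * x ≤ (2 * v - v ^ 2) * |x| := by
  rcases le_or_gt 0 x with hx | hx
  · -- `x ≥ 0`: `x - X ≤ v x`
    rw [abs_of_nonneg hx] at hN ⊢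
    have h1 : x - X ≤ v * x := by
      have := le_abs_self (x - X); rw [abs_sub_comm] at hN; linarith
    have h2 : (1 - v) * (x - X) ≤ (1 - v) * (v * x) :=
      mul_le_mul_of_nonneg_left h1 (by linarith)
    linarith
  · -- `x < 0`: `X ≤ 0`; either `X < x` (inflation, rate `w`) or `x - X ≤ 0`
    have hX := hSm hx.le
    rw [abs_of_neg hx] at hN hI ⊢
    rcases le_or_gt (x - X) 0 with hd | hd
    · have h2 : 0 ≤ (1 - v) * (X - x) := mul_nonneg (by linarith) (by linarith)
      have h3 : 0 ≤ (3 * v - v ^ 2) * (-x) := mul_nonneg (by nlinarith) (by linarith)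
      linarith
    · have hinf : -x < |X| := by rw [abs_of_nonpos hX]; linarith
      have h2 := hI hinf
      rw [abs_of_nonpos (by linarith : X - x ≤ 0)] at h2
      have h4 : (1 - v) * (x - X) ≤ (1 - v) * (w * -x) :=
        mul_le_mul_of_nonneg_left (by linarith) (by linarith)
      have h5 : (1 - v) * w ≤ 3 * v - v ^ 2 := by nlinarith
      have h7 : (1 - v) * w * (-x) ≤ (3 * v - v ^ 2) * (-x) :=
        mul_le_mul_of_nonneg_right h5 (by linarith)
      linarith

/-- INFLATION PIECE: if the ancestor inflates, an operand `x ↦ X` contributes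
`(1+w)(x - X) - w·x ≤ (2v - v²)|x|`; the binding instance is a fully inflated negative operand,
`2w + w² ≤ 2v - v²` (`two_infl_le_law`). Uses (N), (I), (S). -/
theorem piece_infl {v w x X : ℚ} (hv0 : 0 ≤ v) (hv1 : v ≤ 1) (hw0 : 0 ≤ w)
    (hP : 2 * w + w ^ 2 ≤ 2 * v - v ^ 2)
    (hN : |X - x| ≤ v * |x|) (hI : |x| < |X| → |X - x| ≤ w * |x|) (hSm : x ≤ 0 → X ≤ 0) :
    (1 + w) * (x - X) - w * x ≤ (2 * v - v ^ 2) * |x| := by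
  rcases le_or_gt 0 x with hx | hx
  · rw [abs_of_nonneg hx] at hN ⊢
    have h1 : x - X ≤ v * x := by
      have := le_abs_self (x - X); rw [abs_sub_comm] at hN; linarith
    have h2 : (1 + w) * (x - X) ≤ (1 + w) * (v * x) := mul_le_mul_of_nonneg_left h1 (by linarith)
    have h3 : 0 ≤ (1 - v) * (w + v) * x := mul_nonneg (mul_nonneg (by linarith) (by linarith)) hx
    linarith
  · have hX := hSm hx.le
    rw [abs_of_neg hx] at hN hI ⊢
    rcases le_or_gt (x - X) 0 with hd | hd
    · have h2 : 0 ≤ (1 + w) * (X - x) := mul_nonneg (by linarith) (by linarith)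
      have h3 : 0 ≤ (2 * v - v ^ 2 - w) * (-x) := mul_nonneg (by nlinarith) (by linarith)
      linarith
    · have hinf : -x < |X| := by rw [abs_of_nonpos hX]; linarith
      have h2 := hI hinf
      rw [abs_of_nonpos (by linarith : X - x ≤ 0)] at h2
      have h4 : (1 + w) * (x - X) ≤ (1 + w) * (w * -x) :=
        mul_le_mul_of_nonneg_left (by linarith) (by linarith)
      have h5 : (2 * w + w ^ 2) * (-x) ≤ (2 * v - v ^ 2) * (-x) :=
        mul_le_mul_of_nonneg_right hP (by linarith)
      linarith

/-! ## §3 The core inequality (one addition above two additions) -/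

/-- ONE-SIDED CORE: three rounded additions `A = fl α`, `C = fl γ`, `S = fl(A + C)` obeying
(N)(I)(S) with rates `v, w` (`0 ≤ w ≤ v ≤ 1`, `2w + w² ≤ 2v - v²`) under-estimate `α + γ` by at most
`(2v - v²)(|α| + |γ|)`. -/
theorem signed4_one_sided {v w α γ A C S : ℚ} (hv0 : 0 ≤ v) (hv1 : v ≤ 1) (hw0 : 0 ≤ w)
    (hwv : w ≤ v) (hP : 2 * w + w ^ 2 ≤ 2 * v - v ^ 2)
    (hNa : |A - α| ≤ v * |α|) (hIa : |α| < |A| → |A - α| ≤ w * |α|) (hSa : α ≤ 0 → A ≤ 0)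
    (hNc : |C - γ| ≤ v * |γ|) (hIc : |γ| < |C| → |C - γ| ≤ w * |γ|) (hSc : γ ≤ 0 → C ≤ 0)
    (hNs : |S - (A + C)| ≤ v * |A + C|) (hIs : |A + C| < |S| → |S - (A + C)| ≤ w * |A + C|)
    (hSsp : 0 ≤ A + C → 0 ≤ S) (hSsm : A + C ≤ 0 → S ≤ 0) :
    (α + γ) - S ≤ (2 * v - v ^ 2) * (|α| + |γ|) := by
  have key : (α + γ) - S = (α - A) + (γ - C) + ((A + C) - S) := by ring
  rcases le_or_gt ((A + C) - S) 0 with h3 | h3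
  · -- the top error does not help
    have ha := piece_zero hv0 hv1 hNa
    have hc := piece_zero hv0 hv1 hNc
    linarith
  · rcases lt_trichotomy (A + C) 0 with hneg | hzero | hpos
    · -- INFLATION at the top (`S < A + C < 0`): `(A+C) - S ≤ -w(A+C)`
      have hS0 : S ≤ 0 := hSsm hneg.le
      have hinf : |A + C| < |S| := by rw [abs_of_neg hneg, abs_of_nonpos hS0]; linarith
      have h := hIs hinf
      rw [abs_of_nonpos (by linarith : S - (A + C) ≤ 0), abs_of_neg hneg] at h
      have ha := piece_infl hv0 hv1 hw0 hP hNa hIa hSa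
      have hc := piece_infl hv0 hv1 hw0 hP hNc hIc hSc
      have split : (α - A) + (γ - C) - w * (A + C)
          = ((1 + w) * (α - A) - w * α) + ((1 + w) * (γ - C) - w * γ) := by ring
      linarith
    · -- `A + C = 0` forces `S = 0`: no top error
      exfalso
      have h1 := hSsp hzero.ge
      have h2 := hSsm hzero.le
      linarith
    · -- DEFLATION at the top (`0 ≤ S < A + C`): `(A+C) - S ≤ v(A+C)`
      have h := hNs
      rw [abs_of_nonpos (by linarith : S - (A + C) ≤ 0), abs_of_pos hpos] at h
      have ha := piece_defl hv0 hv1 hw0 hwv hNa hIa hSa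
      have hc := piece_defl hv0 hv1 hw0 hwv hNc hIc hSc
      have split : (α - A) + (γ - C) + v * (A + C)
          = ((1 - v) * (α - A) + v * α) + ((1 - v) * (γ - C) + v * γ) := by ring
      linarith

/-- **TWO-SIDED CORE**: under (N)(I)(S) at the three additions (both sign directions),
`|S - (α + γ)| ≤ (2v - v²)(|α| + |γ|)`. The other side is the one-sided core applied to the mirrored
configuration `(-α, -A), (-γ, -C), -S`. -/
theorem signed4_core {v w α γ A C S : ℚ} (hv0 : 0 ≤ v) (hv1 : v ≤ 1) (hw0 : 0 ≤ w)
    (hwv : w ≤ v) (hP : 2 * w + w ^ 2 ≤ 2 * v - v ^ 2)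
    (hNa : |A - α| ≤ v * |α|) (hIa : |α| < |A| → |A - α| ≤ w * |α|)
    (hSap : 0 ≤ α → 0 ≤ A) (hSam : α ≤ 0 → A ≤ 0)
    (hNc : |C - γ| ≤ v * |γ|) (hIc : |γ| < |C| → |C - γ| ≤ w * |γ|)
    (hScp : 0 ≤ γ → 0 ≤ C) (hScm : γ ≤ 0 → C ≤ 0)
    (hNs : |S - (A + C)| ≤ v * |A + C|) (hIs : |A + C| < |S| → |S - (A + C)| ≤ w * |A + C|)
    (hSsp : 0 ≤ A + C → 0 ≤ S) (hSsm : A + C ≤ 0 → S ≤ 0) :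
    |S - (α + γ)| ≤ (2 * v - v ^ 2) * (|α| + |γ|) := by
  rw [abs_sub_comm, abs_le]
  constructor
  · -- mirrored configuration
    have h := signed4_one_sided (α := -α) (γ := -γ) (A := -A) (C := -C) (S := -S)
      hv0 hv1 hw0 hwv hP
      (by rw [neg_sub_neg, abs_sub_comm, abs_neg]; exact hNa)
      (by rw [abs_neg, abs_neg, neg_sub_neg, abs_sub_comm]; exact hIa)
      (fun h => by have := hSap (by linarith); linarith)
      (by rw [neg_sub_neg, abs_sub_comm, abs_neg]; exact hNc)
      (by rw [abs_neg, abs_neg, neg_sub_neg, abs_sub_comm]; exact hIc)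
      (fun h => by have := hScp (by linarith); linarith)
      (by rw [show -S - (-A + -C) = -(S - (A + C)) by ring, abs_neg,
            show -A + -C = -(A + C) by ring, abs_neg]; exact hNs)
      (by rw [show -A + -C = -(A + C) by ring, abs_neg, abs_neg,
            show -S - -(A + C) = -(S - (A + C)) by ring, abs_neg]; exact hIs)
      (fun h => by have := hSsm (by linarith); linarith)
      (fun h => by have := hSsp (by linarith); linarith)
    rw [abs_neg, abs_neg] at h
    linarith
  · exact signed4_one_sided hv0 hv1 hw0 hwv hP hNa hIa hSam hNc hIc hScm hNs hIs hSsp hSsm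

/-! ## §4 In the bit-level formats -/

/-- (N)(I)(S) FOR ONE ADDITION OF FORMAT `α` (`m ≥ 1`): for data `y, z` with `|y + z| ≤ maxRat`,
the saturating RNE sum `X = fl(y+z)` satisfies `|X - (y+z)| ≤ u/(1+u)·|y+z|`
[JeannerodRump2018, (4.1)], `|y+z| < |X| → |X - (y+z)| ≤ u/(1+2u+2u²)·|y+z|`
(`MiniFloat.abs_err_lt_of_inflation`), and weak sign preservation. -/
theorem flα_addition_facts (α : Format) (hm : 1 ≤ α.manBits) (y z : MiniFloat α)
    (h : |y.toRat + z.toRat| ≤ α.maxRat) :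
    |flα α (y.toRat + z.toRat) - (y.toRat + z.toRat)|
        ≤ α.unitRoundoff / (1 + α.unitRoundoff) * |y.toRat + z.toRat| ∧
    (|y.toRat + z.toRat| < |flα α (y.toRat + z.toRat)| →
      |flα α (y.toRat + z.toRat) - (y.toRat + z.toRat)|
        ≤ α.unitRoundoff / (1 + 2 * α.unitRoundoff + 2 * α.unitRoundoff ^ 2)
            * |y.toRat + z.toRat|) ∧
    (0 ≤ y.toRat + z.toRat → 0 ≤ flα α (y.toRat + z.toRat)) ∧
    (y.toRat + z.toRat ≤ 0 → flα α (y.toRat + z.toRat) ≤ 0) := by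
  refine ⟨?_, ?_, ?_, ?_⟩
  · rw [flα_eq_flJR h, ← unitRoundoff_succ_manBits]
    exact abs_err_add_le_sharp (by omega) (Format.isRoundNearest_flJR α) (isFloat_toRat y)
      (isFloat_toRat z)
  · intro hinf
    have hD : 0 < 1 + 2 * α.unitRoundoff + 2 * α.unitRoundoff ^ 2 := by
      have := α.unitRoundoff_pos; positivity
    have hlt := abs_err_lt_of_inflation hm y z h hinf
    rw [div_mul_eq_mul_div, le_div_iff₀ hD]
    exact hlt.le
  · intro h0
    have := toRat_roundNE_mono (φ := α) h0
    rw [toRat_roundNE_zero] at this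
    exact this
  · intro h0
    have := toRat_roundNE_mono (φ := α) h0
    rw [toRat_roundNE_zero] at this
    exact this

/-- **CONJECTURE S′ AT HEIGHT TWO — THE BALANCED FOUR-LEAF TREE OBEYS THE SIGNED LAW.**  For every
format `α` with `m ≥ 1` (all FP4/FP6/FP8, fp16, bf16, fp32, P3109) and data `a, b, c, d` of ANY signs
with the three additions in range: `|fl(fl(a+b)+fl(c+d)) - (a+b+c+d)| ≤ (2u+u²)/(1+u)²·Σ|xᵢ|`. -/
theorem signed_law_height_two (α : Format) (hm : 1 ≤ α.manBits) (a b c d : MiniFloat α)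
    (hab : |a.toRat + b.toRat| ≤ α.maxRat) (hcd : |c.toRat + d.toRat| ≤ α.maxRat)
    (htop : |flα α (a.toRat + b.toRat) + flα α (c.toRat + d.toRat)| ≤ α.maxRat) :
    |flα α (flα α (a.toRat + b.toRat) + flα α (c.toRat + d.toRat))
        - (a.toRat + b.toRat + c.toRat + d.toRat)|
      ≤ (2 * α.unitRoundoff + α.unitRoundoff ^ 2) / (1 + α.unitRoundoff) ^ 2
          * (|a.toRat| + |b.toRat| + |c.toRat| + |d.toRat|) := by
  have hu := format_unitRoundoff_nonneg α
  obtain ⟨hw0, hwv, hv0, hv1⟩ := rates_basic hu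
  have hP := two_infl_le_law hu
  obtain ⟨hNa, hIa, hSap, hSam⟩ := flα_addition_facts α hm a b hab
  obtain ⟨hNc, hIc, hScp, hScm⟩ := flα_addition_facts α hm c d hcd
  obtain ⟨hNs, hIs, hSsp, hSsm⟩ :=
    flα_addition_facts α hm (roundNE α (a.toRat + b.toRat)) (roundNE α (c.toRat + d.toRat)) htop
  have core := signed4_core hv0 hv1 hw0 hwv hP hNa hIa hSap hSam hNc hIc hScp hScm hNs hIs hSsp hSsm
  obtain ⟨hlaw1, hlaw2⟩ := law_height_two_eq hu
  rw [show a.toRat + b.toRat + c.toRat + d.toRat = (a.toRat + b.toRat) + (c.toRat + d.toRat) by ring,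
    ← hlaw2, ← hlaw1]
  refine le_trans core (mul_le_mul_of_nonneg_left ?_ (by nlinarith))
  linarith [abs_add_le a.toRat b.toRat, abs_add_le c.toRat d.toRat]

/-- TREE FORM: for the balanced four-leaf tree `t = ((a,b),(c,d))` with leaves in `F_α` and every
node in range (`TreeInRange α t`), `|ŝ - s| ≤ (1 - 1/M_t(u_α)) · Σ|xᵢ|` with `M_t(u) = (1+u)²` —
the signed tree-polynomial law holds for this tree at every precision (contrast
`OptTreePolySignedRefutation.not_signed_treePoly_law` for `τ₉`). -/
theorem signed_law_height_two_tree (α : Format) (hm : 1 ≤ α.manBits) (a b c d : ℚ)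
    (ht : TreeInRange α (node (node (leaf a) (leaf b)) (node (leaf c) (leaf d)))) :
    |eval (flα α) (node (node (leaf a) (leaf b)) (node (leaf c) (leaf d)))
        - exact (node (node (leaf a) (leaf b)) (node (leaf c) (leaf d)))|
      ≤ (1 - 1 / treeM α.unitRoundoff (node (node (leaf a) (leaf b)) (node (leaf c) (leaf d))))
          * absSum (node (node (leaf a) (leaf b)) (node (leaf c) (leaf d))) := by
  simp only [TreeInRange] at ht
  obtain ⟨⟨⟨ya, hya⟩, ⟨yb, hyb⟩, hab⟩, ⟨⟨yc, hyc⟩, ⟨yd, hyd⟩, hcd⟩, htop⟩ := ht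
  simp only [eval] at hab hcd htop
  have hM : treeM α.unitRoundoff (node (node (leaf a) (leaf b)) (node (leaf c) (leaf d)))
      = (1 + α.unitRoundoff) ^ 2 := by simp only [treeM_node, treeM_leaf, max_self, min_self]; ring
  have hL : absSum (node (node (leaf a) (leaf b)) (node (leaf c) (leaf d)))
      = |a| + |b| + |c| + |d| := by simp [absSum, leaves]; ring
  rw [hM, hL]
  simp only [eval, exact]
  subst hya hyb hyc hyd
  rw [(law_height_two_eq (format_unitRoundoff_nonneg α)).2]
  have h := signed_law_height_two α hm ya yb yc yd hab hcd htop
  rwa [show ya.toRat + yb.toRat + yc.toRat + yd.toRat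
      = ya.toRat + yb.toRat + (yc.toRat + yd.toRat) by ring] at h

/-- **THE EXACT SIGNED WORST CASE OF THE BALANCED FOUR-LEAF TREE IS `1 - 1/(1+u)²`** (format `α`,
`m ≥ 1`): the bound of `signed_law_height_two_tree` holds for all signed in-range data, and it is
ATTAINED (by nonnegative data: T4(b)'s witness `((2^e(1+u), 2^e u),(2^e u, 2^e u²))` whenever the
exponent range accommodates it, `qexp α + 2(m+1) ≤ e`, `2^e(1+u) ≤ maxRat α`). -/
theorem signed_worst_case_height_two (α : Format) (hm : 1 ≤ α.manBits) {e : ℤ}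
    (he : α.qexp + (((α.manBits + 1) * 2 : ℕ) : ℤ) ≤ e)
    (hrange : (2 : ℚ) ^ e * (1 + α.unitRoundoff) ≤ α.maxRat) :
    (∀ a b c d : ℚ, TreeInRange α (node (node (leaf a) (leaf b)) (node (leaf c) (leaf d))) →
      |eval (flα α) (node (node (leaf a) (leaf b)) (node (leaf c) (leaf d)))
          - exact (node (node (leaf a) (leaf b)) (node (leaf c) (leaf d)))|
        ≤ (1 - 1 / (1 + α.unitRoundoff) ^ 2) * (|a| + |b| + |c| + |d|)) ∧
    (∃ a b c d : ℚ, TreeInRange α (node (node (leaf a) (leaf b)) (node (leaf c) (leaf d))) ∧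
      0 < |a| + |b| + |c| + |d| ∧
      |eval (flα α) (node (node (leaf a) (leaf b)) (node (leaf c) (leaf d)))
          - exact (node (node (leaf a) (leaf b)) (node (leaf c) (leaf d)))|
        = (1 - 1 / (1 + α.unitRoundoff) ^ 2) * (|a| + |b| + |c| + |d|)) := by
  have hu := format_unitRoundoff_nonneg α
  have hM : ∀ a b c d : ℚ,
      treeM α.unitRoundoff (node (node (leaf a) (leaf b)) (node (leaf c) (leaf d)))
        = (1 + α.unitRoundoff) ^ 2 := by
    intro a b c d; simp only [treeM_node, treeM_leaf, max_self, min_self]; ring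
  have hL : ∀ a b c d : ℚ, absSum (node (node (leaf a) (leaf b)) (node (leaf c) (leaf d)))
      = |a| + |b| + |c| + |d| := by
    intro a b c d; simp [absSum, leaves]; ring
  refine ⟨fun a b c d ht => ?_, ?_⟩
  · have h := signed_law_height_two_tree α hm a b c d ht
    rwa [hM, hL] at h
  · -- T4(b)'s witness for this tree, transferred to the format by `treePoly_attained_format`
    set s : ℚ := (2 : ℚ) ^ e with hs
    set u : ℚ := α.unitRoundoff with hu_def
    have hpos : 0 < s := by rw [hs]; positivity
    have hw := treePoly_attained_format hm (node (node (leaf s) (leaf s)) (node (leaf s) (leaf s)))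
      (e := e) (by simpa [height] using he) hrange
    have hwit : wit u s (node (node (leaf s) (leaf s)) (node (leaf s) (leaf s))) 0
        = node (node (leaf s) (leaf (s * u))) (node (leaf (s * u)) (leaf (s * u ^ 2))) := by
      simp [wit, treeM]
    rw [hwit] at hw
    obtain ⟨hT, -, -, hev, hex, -⟩ := hw
    have hsu : 0 ≤ s * u := mul_nonneg hpos.le hu
    have hsu2 : 0 ≤ s * u ^ 2 := mul_nonneg hpos.le (pow_nonneg hu 2)
    have hLpos : 0 < |s| + |s * u| + |s * u| + |s * u ^ 2| := by
      have h1 : 0 < |s| := abs_pos.mpr hpos.ne'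
      have h2 := abs_nonneg (s * u)
      have h3 := abs_nonneg (s * u ^ 2)
      linarith
    refine ⟨s, s * u, s * u, s * u ^ 2, hT, hLpos, ?_⟩
    rw [hev, hex, hM]
    have h1 : (1 : ℚ) + u ≠ 0 := by intro h; linarith
    have hdef : s - s * (1 + u) ^ 2 ≤ 0 := by
      have : s ≤ s * (1 + u) ^ 2 := by nlinarith
      linarith
    rw [abs_of_nonneg hpos.le, abs_of_nonneg hsu, abs_of_nonneg hsu2, abs_of_nonpos hdef]
    field_simp
    ring

/-! ## §5 Why the relaxation stops at height two (honest scope) -/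

/-- AT HEIGHT THREE THE RELAXATION (N)(I)(S) IS NOT ENOUGH: an all-inflation chain of three levels
would be worth `(1+w)³ - 1`, which EXCEEDS the law `1 - 1/(1+u)³` — at `u = 2^-4` (E4M3),
`2^-8` (bfloat16), `2^-11` (binary16), `2^-24` (binary32), and to second order in general
(`3u - 3u² + …` against `3u - 6u² + …`). A proof of Conjecture S′ for the eight-leaf tree must
therefore use the grid structure of the format (which additions can inflate by nearly `w` at the
same time), not only the three per-addition facts. -/
theorem relaxation_exceeds_law_height_three :
    (∀ u ∈ [(1/16 : ℚ), 1/256, 1/2048, 1/16777216],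
      1 - 1 / (1 + u) ^ 3 < (1 + u / (1 + 2 * u + 2 * u ^ 2)) ^ 3 - 1) ∧
    (∀ u ∈ [(1/16 : ℚ), 1/256, 1/2048, 1/16777216],
      (1 + u / (1 + 2 * u + 2 * u ^ 2)) ^ 2 - 1 < 1 - 1 / (1 + u) ^ 2) := by
  refine ⟨?_, ?_⟩ <;> intro u hu <;>
    simp only [List.mem_cons, List.not_mem_nil, or_false] at hu <;>
    rcases hu with rfl | rfl | rfl | rfl <;> norm_num

end Summit.Ventures.CertifiedArithmetic.LowPrec.Opt
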